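import Literature.AlgebraicGeometry.Morphisms.CechH1Localization
import Literature.AlgebraicGeometry.Morphisms.CechH1Leray
import Literature.AlgebraicGeometry.Morphisms.CechModuleAffine
import Literature.AlgebraicGeometry.Morphisms.CechModuleUnit
import HarnessLib

/-!
# Lengths of Čech `H¹`: independence of the affine cover, change of structure ring, localisation

[OURS · L W4.4 · support for the kill test `SurfaceTermination` stmt-ResolutionOfSingularities-16488,
assembly `stub_pgNonincreasing` (U2e) of res-D-pv-045's programme; seat res-L0-w44-stub-4.]
Fact-free consequences of the tree's Čech files, stated for the LENGTH `length_A Ȟ¹(𝒰, 𝒪_X) ∈ ℕ∞`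
(the quantity bounded in `HasGeometricGenusLE`).  NOT a statement of any manuscript under review
(Hironaka 2017). AI-written; AI review is weaker than expert review.

* §1 **independence of the affine cover** (Hartshorne III Thm. 4.5 in degree `1`, for lengths): for a
  family `𝒰` of AFFINE opens and a refinement `𝒱` covering every `U_i`, the refinement map
  `Ȟ¹(𝒰, 𝒪_X) → Ȟ¹(𝒱, 𝒪_X)` is bijective (injective: Görtz–Wedhorn II Cor. 21.81, tree
  `cechRefineH1_injective`; surjective: tree `cechRefineH1_surjective` with the affine vanishing
  `cechMZ1_le_cechMB1_of_isAffineOpen` on each `U_i`), so the lengths agree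
  (`length_cechH1_eq_of_refine`); for two families of affine opens both covering `X` the lengths agree
  (`length_cechH1_eq_of_isAffineOpen`, through the common refinement). No separatedness is needed.
* §2 **change of structure ring**: for `φ : A → A'` and an `A'`-scheme `f' : Y → Spec A'` regarded as
  an `A`-scheme through `f = f' ≫ Spec φ`, the Čech groups are the same abelian groups with `A` acting
  through `φ` (`exists_addEquiv_cechH1_comp`), hence `length_{A'} Ȟ¹(𝒰, 𝒪_Y) ≤ length_A Ȟ¹(𝒰, 𝒪_Y)`
  (`length_cechH1_le_length_cechH1_comp`, `length_cechH1_le_length_cechH1_comp'`).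
* §3 **localisation** (EGA III (1.4.15) for lengths): in the situation of
  `CechLocalization.isLocalizedModule_cechComapH1` (`A → A' = S⁻¹A`, `g : Y = X ×_A Spec A' → X`,
  `𝒰` affine with affine pairwise and triple intersections),
  `length_{A'} Ȟ¹(g⁻¹𝒰, 𝒪_Y) ≤ length_A Ȟ¹(𝒰, 𝒪_X)` (`length_cechH1_le_of_isLocalization`;
  localisation does not increase length).

Use (W4.4 kill test, U2e): §3 bounds `p_g` of the next stage `T_(m+2) = N_𝔮` by the length over `N`
of `Ȟ¹` of the chart `V → Spec N`; §2 passes from `N` to the stage ring `T_(m+1) ⊆ N`; §1 turns the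
bound for one affine cover of the resolution of `T_(m+2)` into the bound for every affine cover.

## References
* R. Hartshorne, *Algebraic Geometry* (1977): III Thm. 4.5 (p. 222). [Hartshorne1977]
* U. Görtz, T. Wedhorn, *Algebraic Geometry II* (2023): Cor. 21.81 (p. 265), Lemma 22.1 (p. 327).
  [GortzWedhorn2023]
* A. Grothendieck, J. Dieudonné, EGA III₁ (1961): Prop. (1.4.15). [EGAIII1]
-/

noncomputable section

open CategoryTheory AlgebraicGeometry Limits TopologicalSpace Opposite
open Literature.AlgebraicGeometry.Modules

universe u v w

namespace Literature.AlgebraicGeometry.Morphisms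

/-! ## §1. Independence of the affine cover -/

section Cover

variable {A : Type u} [CommRing A] {X : Scheme.{u}} (f : X ⟶ Spec (.of A))

/-- **Affine vanishing for the structure sheaf**: on an affine open `V`, every Čech `1`-cocycle of
`𝒪_X` on ANY family of opens `(W_j)` with `⋃ W_j = V` is a coboundary (the unit-module case of
`cechMZ1_le_cechMB1_of_isAffineOpen`). [cite: GortzWedhorn2023, Lemma 22.1 (p. 327) with Cor. 21.81 (p. 265)] -/
theorem cechZ1_le_cechB1_of_isAffineOpen_of_iSup_eq {V : X.Opens} (hV : IsAffineOpen V) {J : Type v}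
    (W : J → X.Opens) (hW : ⨆ j, W j = V) : cechZ1 f W ≤ cechB1 f W :=
  cechMZ1_le_cechMB1_of_isAffineOpen f IsAffineLocalizing.unit hV W hW

variable {ι : Type v} {ι' : Type w} (U : ι → X.Opens) (V : ι' → X.Opens) (τ : ι' → ι)
  (hτ : ∀ j, V j ≤ U (τ j))

/-- **The refinement map `Ȟ¹(𝒰, 𝒪_X) → Ȟ¹(𝒱, 𝒪_X)` is bijective** when the `U_i` are affine and
`𝒱` covers every `U_i`. [cite: Hartshorne1977, III Thm. 4.5 p. 222 (cover independence, degree 1)] -/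
theorem cechRefineH1_bijective_of_isAffineOpen (hUaff : ∀ i, IsAffineOpen (U i))
    (hU : ∀ i, U i ≤ ⨆ j, V j) : Function.Bijective (cechRefineH1 f U V τ hτ) := by
  refine ⟨cechRefineH1_injective f U V τ hτ hU, cechRefineH1_surjective f U V τ hτ hU fun i => ?_⟩
  refine cechZ1_le_cechB1_of_isAffineOpen_of_iSup_eq f (hUaff i) _ ?_
  rw [← inf_iSup_eq]
  exact inf_eq_left.mpr (hU i)

include τ hτ in
/-- **`length_A Ȟ¹(𝒰, 𝒪_X) = length_A Ȟ¹(𝒱, 𝒪_X)`** for `𝒰` affine and a refinement `𝒱` covering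
every `U_i`. [cite: Hartshorne1977, III Thm. 4.5 p. 222 (cover independence, degree 1)] -/
theorem length_cechH1_eq_of_refine (hUaff : ∀ i, IsAffineOpen (U i)) (hU : ∀ i, U i ≤ ⨆ j, V j) :
    Module.length A (CechH1 f U) = Module.length A (CechH1 f V) :=
  (LinearEquiv.ofBijective (cechRefineH1 f U V τ hτ)
    (cechRefineH1_bijective_of_isAffineOpen f U V τ hτ hUaff hU)).length_eq

/-- `U_i ⊆ ⋃_{(i',j)} U_{i'} ∩ V_j` when `𝒱` covers `X`. [folklore] -/
private theorem le_iSup_prod_inf_left (hV : ⨆ j, V j = ⊤) (i : ι) :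
    U i ≤ ⨆ p : ι × ι', U p.1 ⊓ V p.2 := by
  intro x hx
  have hxV : x ∈ (⨆ j, V j) := by rw [hV]; trivial
  obtain ⟨j, hj⟩ := Opens.mem_iSup.mp hxV
  exact Opens.mem_iSup.mpr ⟨(i, j), ⟨hx, hj⟩⟩

/-- `V_j ⊆ ⋃_{(i,j')} U_i ∩ V_{j'}` when `𝒰` covers `X`. [folklore] -/
private theorem le_iSup_prod_inf_right (hU : ⨆ i, U i = ⊤) (j : ι') :
    V j ≤ ⨆ p : ι × ι', U p.1 ⊓ V p.2 := by
  intro x hx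
  have hxU : x ∈ (⨆ i, U i) := by rw [hU]; trivial
  obtain ⟨i, hi⟩ := Opens.mem_iSup.mp hxU
  exact Opens.mem_iSup.mpr ⟨(i, j), ⟨hi, hx⟩⟩

/-- **Independence of the affine cover, for lengths**: two families of AFFINE opens `𝒰`, `𝒱` both
covering `X` have `length_A Ȟ¹(𝒰, 𝒪_X) = length_A Ȟ¹(𝒱, 𝒪_X)` (both equal the length on the common
refinement `(U_i ∩ V_j)`). [cite: Hartshorne1977, III Thm. 4.5 p. 222 (cover independence, degree 1)] -/
theorem length_cechH1_eq_of_isAffineOpen (hUaff : ∀ i, IsAffineOpen (U i))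
    (hVaff : ∀ j, IsAffineOpen (V j)) (hU : ⨆ i, U i = ⊤) (hV : ⨆ j, V j = ⊤) :
    Module.length A (CechH1 f U) = Module.length A (CechH1 f V) := by
  let W : ι × ι' → X.Opens := fun p => U p.1 ⊓ V p.2
  have hWU : ∀ i, U i ≤ ⨆ p, W p := le_iSup_prod_inf_left U V hV
  have hWV : ∀ j, V j ≤ ⨆ p, W p := le_iSup_prod_inf_right U V hU
  rw [length_cechH1_eq_of_refine f U W Prod.fst (fun p => inf_le_left) hUaff hWU,
    length_cechH1_eq_of_refine f V W Prod.snd (fun p => inf_le_right) hVaff hWV]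

end Cover

/-! ## §2. Change of structure ring -/

section BaseRingHom

variable {A A' : Type u} [CommRing A] [CommRing A'] (φ : A →+* A') {Y : Scheme.{u}}
  (fY' : Y ⟶ Spec (.of A'))

/-- The structure maps agree: `a ↦ a·1_Y` through `f' ≫ Spec φ` is `(φ a)·1_Y` through `f'`.
[cite: EGAIII1, Prop. (1.4.15)] -/
theorem algebraMapΓ_comp (a : A) :
    algebraMapΓ (fY' ≫ Spec.map (CommRingCat.ofHom φ)) a = algebraMapΓ fY' (φ a) := by
  change ((fY' ≫ Spec.map (CommRingCat.ofHom φ)).appTop.hom.comp (Scheme.ΓSpecIso (.of A)).inv.hom) a =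
    (fY'.appTop.hom.comp (Scheme.ΓSpecIso (.of A')).inv.hom) (φ a)
  have hnat := Scheme.ΓSpecIso_inv_naturality (CommRingCat.ofHom φ)
  rw [Scheme.Hom.comp_appTop]
  change fY'.appTop.hom (((Scheme.ΓSpecIso (.of A)).inv ≫
      (Spec.map (CommRingCat.ofHom φ)).appTop).hom a) =
    fY'.appTop.hom ((Scheme.ΓSpecIso (.of A')).inv.hom (φ a))
  rw [← hnat]
  rfl

/-- Scalars on sections: `algebraMap A Γ(Y, V)` through `f' ≫ Spec φ` is `algebraMap A' Γ(Y, V) ∘ φ`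
through `f'` (same ring `Γ(Y, V)`). [cite: EGAIII1, Prop. (1.4.15)] -/
theorem algebraMap_sections_comp (V : Y.Opens) (a : A) :
    (algebraMap A (Sections (fY' ≫ Spec.map (CommRingCat.ofHom φ)) V) a : Γ(Y, V)) =
      algebraMap A' (Sections fY' V) (φ a) := by
  rw [Sections.algebraMap_apply, Sections.algebraMap_apply, algebraMapΓ_comp]

end BaseRingHom

section BaseAlgebra

variable {A A' : Type u} [CommRing A] [CommRing A'] [Algebra A A'] {Y : Scheme.{u}}
  (fY' : Y ⟶ Spec (.of A')) {ι : Type v} (U : ι → Y.Opens)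

/-- **`Ȟ¹(𝒰, 𝒪_Y)` through `f' ≫ Spec(A → A')` IS `Ȟ¹(𝒰, 𝒪_Y)` through `f'`, with `A` acting through
`A → A'`**: the identity on cocycles induces an additive isomorphism carrying `a • x` to
`(algebraMap A A' a) • x` (same cochains, same differentials; only the module of scalars changes).
[cite: EGAIII1, Prop. (1.4.15)] -/
theorem exists_addEquiv_cechH1_comp :
    ∃ ψ : CechH1 (fY' ≫ Spec.map (CommRingCat.ofHom (algebraMap A A'))) U ≃+ CechH1 fY' U,
      ∀ (a : A) (x : CechH1 (fY' ≫ Spec.map (CommRingCat.ofHom (algebraMap A A'))) U),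
        ψ (a • x) = algebraMap A A' a • ψ x := by
  -- `A` acts on the `f'`-cochains through `A → A'`
  letI mC : Module A (CechC1 fY' U) := Module.compHom _ (algebraMap A A')
  haveI tC : IsScalarTower A A' (CechC1 fY' U) := IsScalarTower.of_algebraMap_smul fun _ _ => rfl
  -- the identity on cochains is `A`-linear
  have key : ∀ (a : A) (c : CechC1 (fY' ≫ Spec.map (CommRingCat.ofHom (algebraMap A A'))) U),
      (show CechC1 fY' U from a • c) = a • (show CechC1 fY' U from c) := by
    intro a c
    funext i j
    exact congrArg (fun t : Γ(Y, U i ⊓ U j) => t * (show Γ(Y, U i ⊓ U j) from c i j))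
      (algebraMap_sections_comp (algebraMap A A') fY' (U i ⊓ U j) a)
  -- cocycles and coboundaries correspond (same differentials)
  have hZ : ∀ c : CechC1 (fY' ≫ Spec.map (CommRingCat.ofHom (algebraMap A A'))) U,
      c ∈ cechZ1 (fY' ≫ Spec.map (CommRingCat.ofHom (algebraMap A A'))) U ↔
        (show CechC1 fY' U from c) ∈ cechZ1 fY' U := fun c => by
    rw [mem_cechZ1_iff, mem_cechZ1_iff]; exact Iff.rfl
  have hB : ∀ c : CechC1 (fY' ≫ Spec.map (CommRingCat.ofHom (algebraMap A A'))) U,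
      c ∈ cechB1 (fY' ≫ Spec.map (CommRingCat.ofHom (algebraMap A A'))) U ↔
        (show CechC1 fY' U from c) ∈ cechB1 fY' U := fun c => by
    rw [mem_cechB1_iff, mem_cechB1_iff]; exact Iff.rfl
  let ψZ : ↥(cechZ1 (fY' ≫ Spec.map (CommRingCat.ofHom (algebraMap A A'))) U) →ₗ[A]
      ↥(cechZ1 fY' U) :=
    { toFun := fun z => ⟨(show CechC1 fY' U from z.1), (hZ z.1).mp z.2⟩
      map_add' := fun _ _ => rfl
      map_smul' := fun a z => Subtype.ext (key a z.1) }
  let q : Submodule A' ↥(cechZ1 fY' U) := (cechB1 fY' U).comap (cechZ1 fY' U).subtype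
  let ψq : CechH1 (fY' ≫ Spec.map (CommRingCat.ofHom (algebraMap A A'))) U →ₗ[A]
      (↥(cechZ1 fY' U) ⧸ q.restrictScalars A) :=
    Submodule.mapQ _ (q.restrictScalars A) ψZ fun z hz => by
      rw [Submodule.mem_comap] at hz
      change (show CechC1 fY' U from z.1) ∈ cechB1 fY' U
      exact (hB z.1).mp hz
  let ρ : (↥(cechZ1 fY' U) ⧸ q.restrictScalars A) ≃ₗ[A] CechH1 fY' U :=
    Submodule.Quotient.restrictScalarsEquiv A q
  let ψ : CechH1 (fY' ≫ Spec.map (CommRingCat.ofHom (algebraMap A A'))) U →ₗ[A] CechH1 fY' U :=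
    (ρ : _ →ₗ[A] CechH1 fY' U) ∘ₗ ψq
  have hψmk : ∀ z, ψ (CechH1.mk _ U z) = CechH1.mk fY' U (ψZ z) := fun z => rfl
  have hψ : Function.Bijective ψ := by
    constructor
    · rw [← LinearMap.ker_eq_bot, LinearMap.ker_eq_bot']
      intro x hx
      obtain ⟨z, rfl⟩ := CechH1.mk_surjective _ U x
      rw [hψmk, CechH1.mk_eq_zero_iff] at hx
      rw [CechH1.mk_eq_zero_iff]
      exact (hB z.1).mpr hx
    · intro y
      obtain ⟨z, rfl⟩ := CechH1.mk_surjective fY' U y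
      exact ⟨CechH1.mk _ U
        ⟨(show CechC1 (fY' ≫ Spec.map (CommRingCat.ofHom (algebraMap A A'))) U from z.1),
          (hZ _).mpr z.2⟩, hψmk _⟩
  refine ⟨(LinearEquiv.ofBijective ψ hψ).toAddEquiv, fun a x => ?_⟩
  change ψ (a • x) = algebraMap A A' a • ψ x
  rw [map_smul]
  obtain ⟨w, hw⟩ := CechH1.mk_surjective fY' U (ψ x)
  rw [← hw]
  rfl

/-- **`length_{A'} Ȟ¹(𝒰, 𝒪_Y) ≤ length_A Ȟ¹(𝒰, 𝒪_Y)`** when the `A`-structure of `Y` is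
`f' ≫ Spec(A → A')`: every `A'`-submodule is an `A`-submodule of the same group.
[cite: EGAIII1, Prop. (1.4.15)] -/
theorem length_cechH1_le_length_cechH1_comp :
    Module.length A' (CechH1 fY' U) ≤
      Module.length A (CechH1 (fY' ≫ Spec.map (CommRingCat.ofHom (algebraMap A A'))) U) := by
  obtain ⟨ψ, hψ⟩ := exists_addEquiv_cechH1_comp (A := A) fY' U
  letI mH : Module A (CechH1 fY' U) := Module.compHom _ (algebraMap A A')
  haveI : IsScalarTower A A' (CechH1 fY' U) := IsScalarTower.of_algebraMap_smul fun _ _ => rfl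
  let e : CechH1 (fY' ≫ Spec.map (CommRingCat.ofHom (algebraMap A A'))) U ≃ₗ[A] CechH1 fY' U :=
    { ψ with map_smul' := fun a x => hψ a x }
  rw [e.length_eq]
  have h := Submodule.length_le_length_restrictScalars A (⊤ : Submodule A' (CechH1 fY' U))
  rw [Submodule.restrictScalars_top] at h
  rwa [Submodule.topEquiv.length_eq, Submodule.topEquiv.length_eq] at h

end BaseAlgebra

section BaseRingHomLength

variable {A A' : Type u} [CommRing A] [CommRing A'] (φ : A →+* A') {Y : Scheme.{u}}
  (fY' : Y ⟶ Spec (.of A')) {ι : Type v} (U : ι → Y.Opens)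

/-- The same for an arbitrary ring homomorphism `φ : A → A'`:
`length_{A'} Ȟ¹(𝒰, 𝒪_Y) ≤ length_A Ȟ¹(𝒰, 𝒪_Y)` with `A` acting through `f' ≫ Spec φ`.
[cite: EGAIII1, Prop. (1.4.15)] -/
theorem length_cechH1_le_length_cechH1_comp' :
    Module.length A' (CechH1 fY' U) ≤
      Module.length A (CechH1 (fY' ≫ Spec.map (CommRingCat.ofHom φ)) U) := by
  letI : Algebra A A' := φ.toAlgebra
  exact length_cechH1_le_length_cechH1_comp fY' U

end BaseRingHomLength

/-! ## §3. Localisation does not increase the length of `Ȟ¹` -/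

section Localization

/-- Localization does not increase length: if `N` is the localization of the `R`-module `M` at `p`
(over the localization `S` of `R`), `λ_S(N) ≤ λ_R(M)` — the `S`-submodules of `N` embed into the
`R`-submodules of `M` by contraction (Mathlib `Submodule.localized'gi`).  (Same statement as the tree's
`Resolution/NearPointColengthDropScheme.length_le_of_isLocalizedModule`, repeated privately to keep the
import graph of `Morphisms/` free of `Resolution/`.) [folklore] -/
private theorem length_le_of_isLocalizedModule' {R S M N : Type*} [CommRing R] [CommRing S]
    [AddCommGroup M] [AddCommGroup N] [Module R M] [Module R N] [Algebra R S] [Module S N]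
    [IsScalarTower R S N] (p : Submonoid R) [IsLocalization p S] (f : M →ₗ[R] N)
    [IsLocalizedModule p f] : Module.length S N ≤ Module.length R M := by
  rw [← WithBot.coe_le_coe, Module.coe_length, Module.coe_length]
  exact Order.krullDim_le_of_strictMono
    (fun N' : Submodule S N => Submodule.comap f (N'.restrictScalars R))
    ((Submodule.localized'gi S p f).gc.monotone_u.strictMono_of_injective
      (Submodule.localized'gi S p f).u_injective)

variable {A : Type u} [CommRing A] (S : Submonoid A) {A' : Type u} [CommRing A'] [Algebra A A']
  [IsLocalization S A']
  {X Y : Scheme.{u}} (fX : X ⟶ Spec (.of A)) (fY' : Y ⟶ Spec (.of A'))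
  (g : Y ⟶ X) (H : IsPullback g fY' fX (Spec.map (CommRingCat.ofHom (algebraMap A A'))))
  {ι : Type v} [Finite ι] (U : ι → X.Opens)

include S H in
/-- **`length_{S⁻¹A} Ȟ¹(g⁻¹𝒰, 𝒪_Y) ≤ length_A Ȟ¹(𝒰, 𝒪_X)`** for the base change
`g : Y = X ×_A Spec S⁻¹A → X` and a finite family `𝒰` of affine opens with affine pairwise and triple
intersections: `Ȟ¹(g⁻¹𝒰, 𝒪_Y) = S⁻¹Ȟ¹(𝒰, 𝒪_X)` (tree `CechLocalization.isLocalizedModule_cechComapH1`)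
and localisation does not increase length; the `S⁻¹A`-structure is that of `f' : Y → Spec S⁻¹A` (§2).
[cite: EGAIII1, Prop. (1.4.15)] -/
theorem length_cechH1_le_of_isLocalization (hU : ∀ i, IsAffineOpen (U i))
    (hU2 : ∀ i j, IsAffineOpen (U i ⊓ U j)) (hU3 : ∀ i j k, IsAffineOpen (U i ⊓ U j ⊓ U k)) :
    Module.length A' (CechH1 fY' (preimageFamily g U)) ≤ Module.length A (CechH1 fX U) := by
  haveI hloc := CechLocalization.isLocalizedModule_cechComapH1 S fX fY' _ g rfl H U hU hU2 hU3
  obtain ⟨ψ, hψ⟩ := exists_addEquiv_cechH1_comp (A := A) fY' (preimageFamily g U)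
  letI mH : Module A (CechH1 fY' (preimageFamily g U)) := Module.compHom _ (algebraMap A A')
  haveI : IsScalarTower A A' (CechH1 fY' (preimageFamily g U)) :=
    IsScalarTower.of_algebraMap_smul fun _ _ => rfl
  let e : CechH1 (fY' ≫ Spec.map (CommRingCat.ofHom (algebraMap A A'))) (preimageFamily g U) ≃ₗ[A]
      CechH1 fY' (preimageFamily g U) :=
    { ψ with map_smul' := fun a x => hψ a x }
  haveI := IsLocalizedModule.of_linearEquiv S (cechComapH1 fX _ g H.w U) e
  exact length_le_of_isLocalizedModule' S
    ((e : _ →ₗ[A] CechH1 fY' (preimageFamily g U)) ∘ₗ cechComapH1 fX _ g H.w U)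

end Localization

end Literature.AlgebraicGeometry.Morphisms

end
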